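import Summits.CriticalPhenomena.SAWScalingLimit.Theorems.SAWDevelopingMapNoFoldBoundNoStarvation
import Summits.CriticalPhenomena.SAWScalingLimit.Theorems.SAWDevelopingMapNoFoldBoundSourceAdjPort
import Summits.CriticalPhenomena.SAWScalingLimit.Theorems.SAWDevelopingMapNoFoldBoundSourceAdjClasses

/-!
# `NoFoldBound`, line Ideator3Sketch — source-adjacent stratum: no middle-port starvation under
# `NoFoldBound` when the touching neighbour is the source vertex

Crux `NoFoldBound` (stmt-CriticalPhenomena-8296), route `SAWDevelopingMap`, lead seat c5 (wave 2, stub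
`noStarvationSrc_of_noFoldBound`). This is the source-position twin of `noStarvation_of_noFoldBound`
(file `…NoStarvation`), i.e. the CONVERSE direction of `sourceAdj_core` (file `…SourceAdjPort`): at an
interior vertex `v` off the source mid-edge `a = {x, w₀}` (`x ∉ Λ`), adjacent to the SOURCE VERTEX `w₀`
(third neighbour `y` of `w₀`, positive labelling `(w₀, w₁, w₂)` at `v`), the uniform no-fold bound FORCES
the middle port not to be starved when the two outer ports are balanced: with `s_j` the dressed
sum-masses of the three ports, `2·min(s_outer, s_outer') ≤ 3·s_mid + max(s_outer, s_outer')` (middle port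
`w₁` if `y → w₀ → v` turns left, `w₂` if it turns right).

Proof: `slitCoherence_of_noFoldBound` turns `NoFoldBound` into the slit-coherence inequality
`‖B₀ + ω B₁ + ω² B₂‖ ≤ k ‖S₀ + S₁ + S₂‖` (`k < 1`) for the dressed port sums; the rigid classes of the
source-adjacent stratum (`stub_sourceAdjClasses` for the ports `p ≠ w₀`, the one-vertex walk `[w₀]`
— `verts_eq_of_sealed_source`, `winding_of_verts_eq_singleton` — for the source port) and the phase
factorisation of `sourceAdj_core` reduce it to the three-class form
`‖b_mid + b_hi e^{13πi/12} + b_lo e^{−13πi/12}‖ ≤ k ‖s_mid + s_hi e^{5πi/12} + s_lo e^{−5πi/12}‖` for the real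
dressed masses. `sourceLoopBound_of_noFoldBound` bounds every slit loop sum by `c < sin(π/8)`, whence the
one-sided dressing facts `b_j ≤ s_j` and `b_j ≥ 0.6137 s_j` (`dressed_oneSided`), and
`three_class_necessary` concludes. [folklore assembly]
-/

noncomputable section

open scoped BigOperators
open Literature.Probability.LatticeModels Literature.Probability.RandomPlanarGeometry.SAW

namespace Summit.CriticalPhenomena.SAWScalingLimit.Theorems.SAWDevelopingMapNoFoldBound

/-! ## The source-adjacent converse -/

/-- **No middle-port starvation next to the source vertex under `NoFoldBound` (source vertex in
position `w₀`, positive labelling).** Let `Λ` be simply connected with source `a = {x, w₀} ∈ ∂Ω`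
(`x ∉ Λ`, `w₀ ∈ Λ` the source vertex, third neighbour `y` of `w₀`), `v ∈ Λ` off `a` with pairwise
distinct neighbours `w₀, w₁, w₂ ∈ Λ` in the positive order (turn `w₀ → v → w₁ = +π/3`). If the uniform
no-fold bound `NoFoldBound` holds, then the dressed sum-masses `s` of the three ports satisfy
`2·min(s(w₀), s(w₂)) ≤ 3·s(w₁) + max(s(w₀), s(w₂))` if `y → w₀ → v` turns left (middle port `w₁`) and
`2·min(s(w₀), s(w₁)) ≤ 3·s(w₂) + max(s(w₀), s(w₁))` if it turns right (middle port `w₂`): the converse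
companion of the dominance hypothesis of `sourceAdj_core`. [folklore assembly] -/
theorem noStarvationSrc_of_noFoldBound
    (hK : Summit.CriticalPhenomena.SAWScalingLimit.Theses.SAWDevelopingMap.NoFoldBound) :
    ∀ (Λ : Finset HexVertex), hexDomainSimplyConnected Λ → ∀ a ∈ hexDomainBoundary Λ,
      ∀ v ∈ Λ, v ∉ a → ∀ w₀ w₁ w₂ x y : HexVertex, hexGraph.Adj v w₀ → hexGraph.Adj v w₁ →
      hexGraph.Adj v w₂ → w₀ ≠ w₁ → w₁ ≠ w₂ → w₀ ≠ w₂ → w₀ ∈ Λ → w₁ ∈ Λ → w₂ ∈ Λ → a = s(x, w₀) →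
      winding [hexMidpoint s(w₀, v), hexCenter v, hexMidpoint s(v, w₁)] = Real.pi / 3 →
      hexGraph.Adj w₀ x → hexGraph.Adj w₀ y → v ≠ x → x ≠ y → v ≠ y → x ∉ Λ →
      let xc : ℝ := hexCriticalFugacity
      let α : ℝ := 1 + 2 * hexCriticalFugacity * Real.cos (5 * Real.pi / 24)
      let s : (w p q : HexVertex) → ℝ := fun w p q =>
        ∑ γ : HexMidEdgeSAW Λ a s(v, w), if v ∉ γ.verts then xc ^ γ.length *
          (α - Real.sqrt 3 * xc *
            ∑ δ : HexMidEdgeSAW ((Λ \ γ.verts.toFinset).erase v) s(v, p) s(v, q), xc ^ δ.length) else 0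
      (winding [hexMidpoint s(y, w₀), hexCenter w₀, hexMidpoint s(w₀, v)] = Real.pi / 3 →
          2 * min (s w₀ w₁ w₂) (s w₂ w₀ w₁) ≤ 3 * s w₁ w₂ w₀ + max (s w₀ w₁ w₂) (s w₂ w₀ w₁)) ∧
        (winding [hexMidpoint s(y, w₀), hexCenter w₀, hexMidpoint s(w₀, v)] = -(Real.pi / 3) →
          2 * min (s w₀ w₁ w₂) (s w₁ w₂ w₀) ≤ 3 * s w₂ w₀ w₁ + max (s w₀ w₁ w₂) (s w₁ w₂ w₀)) := by
  intro Λ hΛ a ha v hv hva w₀ w₁ w₂ xo y h₀ h₁ h₂ h₀₁ h₁₂ h₀₂ hw₀ hw₁ hw₂ hax hchir hwx hwy hvx hxy hvy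
    hx
  dsimp only
  -- the two consequences of `NoFoldBound`: slit coherence (`k < 1`) and the slit-loop bound (`c < sin(π/8)`)
  obtain ⟨k, hk, H⟩ := slitCoherence_of_noFoldBound stub_portRenewal stub_slitSC hK
  obtain ⟨c, hc, HL⟩ := sourceLoopBound_of_noFoldBound hK
  have hint : ∀ u : HexVertex, hexGraph.Adj v u → u ∈ Λ := by
    intro u hvu
    rcases adj_cases h₀ h₁ h₂ h₀₁ h₁₂ h₀₂ hvu with rfl | rfl | rfl
    · exact hw₀
    · exact hw₁
    · exact hw₂
  have H1 := H Λ hΛ a ha v hv hva hint w₀ w₁ w₂ h₀ h₁ h₂ h₀₁ h₁₂ h₀₂ hchir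
  clear H
  dsimp only at H1
  -- the turns at `v` from the chirality
  obtain ⟨ε, hε, T01, -, T20, T10, -, -⟩ := stub_localTurns v w₀ w₁ w₂ h₀ h₁ h₂ h₀₁ h₁₂ h₀₂
  have hε1 : ε = 1 := by
    rcases hε with h | h
    · exact h
    · exfalso
      rw [h] at T01
      have := Real.pi_pos
      linarith [T01.symm.trans hchir]
  subst hε1
  simp only [one_mul] at T20 T10
  -- the turns at `w₀` (neighbours `y, v, x`)
  obtain ⟨ε', hε', Tyv, -, Txy, Tvy, Txv, -⟩ :=
    stub_localTurns w₀ y v xo hwy h₀.symm hwx hvy.symm hvx hxy.symm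
  -- the rigid classes: ports `w₁, w₂` from `stub_sourceAdjClasses`, the source port `w₀` = the
  -- one-vertex walk `[w₀]`; the offset of the class of `w₀` relative to `w₁` is `δ₀ = (3ε' - 1)π/3`
  have hC : ∀ p : HexVertex, hexGraph.Adj v p → p ≠ w₀ → ∀ γ : HexMidEdgeSAW Λ a s(v, p),
      v ∉ γ.verts →
      γ.winding = -5 * winding [hexMidpoint s(xo, w₀), hexCenter w₀, hexMidpoint s(w₀, y)] -
        winding [hexMidpoint s(p, v), hexCenter v, hexMidpoint s(v, w₀)] -
        winding [hexMidpoint s(v, w₀), hexCenter w₀, hexMidpoint s(w₀, y)] :=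
    fun p hp hpw γ hγ => stub_sourceAdjClasses Λ hΛ a ha v w₀ xo y p hv hva hw₀ hax h₀.symm hwx hwy
      hvx hxy hvy hx hp hpw γ hγ
  set W : ℝ := -5 * (ε' * (Real.pi / 3)) + Real.pi / 3 + ε' * (Real.pi / 3) with hWdef
  set δ₀ : ℝ := (3 * ε' - 1) * (Real.pi / 3) with hδ₀
  have hW₁ : ∀ γ : HexMidEdgeSAW Λ a s(v, w₁), v ∉ γ.verts → γ.winding = W := by
    intro γ hγ
    have h := hC w₁ h₁ h₀₁.symm γ hγ
    rw [Txy, T10, Tvy] at h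
    rw [h, hWdef]; ring
  have hW₂ : ∀ γ : HexMidEdgeSAW Λ a s(v, w₂), v ∉ γ.verts → γ.winding = W + -(2 * Real.pi / 3) := by
    intro γ hγ
    have h := hC w₂ h₂ h₀₂.symm γ hγ
    rw [Txy, T20, Tvy] at h
    rw [h, hWdef]; ring
  have hw₀a : w₀ ∈ a := by rw [hax]; exact Sym2.mem_mk_right xo w₀
  have hW₀ : ∀ γ : HexMidEdgeSAW Λ a s(v, w₀), v ∉ γ.verts → γ.winding = W + δ₀ := by
    intro γ hγ
    rw [winding_of_verts_eq_singleton γ (verts_eq_of_sealed_source ha hw₀ hw₀a hva γ hγ), hax, Txv,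
      hWdef, hδ₀]
    ring
  set x := hexCriticalFugacity with hxc
  set α : ℝ := 1 + 2 * x * Real.cos (5 * Real.pi / 24) with hα
  set β : ℝ := 1 + 2 * x * Real.cos (11 * Real.pi / 24) with hβ
  set ω : ℂ := Complex.exp (2 * Real.pi * Complex.I / 3) with hω
  have x0 : 0 ≤ x := nfb_xc_pos.le
  have hω1 : ‖ω‖ = 1 := norm_omega
  -- the six sums
  set S0 := ∑ γ : HexMidEdgeSAW Λ a s(v, w₀), if v ∉ γ.verts then γ.weight x (5 / 8) * ((α - Real.sqrt 3 * x *
    ∑ δ : HexMidEdgeSAW ((Λ \ γ.verts.toFinset).erase v) s(v, w₁) s(v, w₂), x ^ δ.length : ℝ) : ℂ) else 0 with hS0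
  set S1 := ∑ γ : HexMidEdgeSAW Λ a s(v, w₁), if v ∉ γ.verts then γ.weight x (5 / 8) * ((α - Real.sqrt 3 * x *
    ∑ δ : HexMidEdgeSAW ((Λ \ γ.verts.toFinset).erase v) s(v, w₂) s(v, w₀), x ^ δ.length : ℝ) : ℂ) else 0 with hS1
  set S2 := ∑ γ : HexMidEdgeSAW Λ a s(v, w₂), if v ∉ γ.verts then γ.weight x (5 / 8) * ((α - Real.sqrt 3 * x *
    ∑ δ : HexMidEdgeSAW ((Λ \ γ.verts.toFinset).erase v) s(v, w₀) s(v, w₁), x ^ δ.length : ℝ) : ℂ) else 0 with hS2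
  set B0 := ∑ γ : HexMidEdgeSAW Λ a s(v, w₀), if v ∉ γ.verts then γ.weight x (5 / 8) * ((β + Real.sqrt 3 * x *
    ∑ δ : HexMidEdgeSAW ((Λ \ γ.verts.toFinset).erase v) s(v, w₁) s(v, w₂), x ^ δ.length : ℝ) : ℂ) else 0 with hB0
  set B1 := ∑ γ : HexMidEdgeSAW Λ a s(v, w₁), if v ∉ γ.verts then γ.weight x (5 / 8) * ((β + Real.sqrt 3 * x *
    ∑ δ : HexMidEdgeSAW ((Λ \ γ.verts.toFinset).erase v) s(v, w₂) s(v, w₀), x ^ δ.length : ℝ) : ℂ) else 0 with hB1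
  set B2 := ∑ γ : HexMidEdgeSAW Λ a s(v, w₂), if v ∉ γ.verts then γ.weight x (5 / 8) * ((β + Real.sqrt 3 * x *
    ∑ δ : HexMidEdgeSAW ((Λ \ γ.verts.toFinset).erase v) s(v, w₀) s(v, w₁), x ^ δ.length : ℝ) : ℂ) else 0 with hB2
  -- the real dressed masses
  set s₀ : ℝ := ∑ γ : HexMidEdgeSAW Λ a s(v, w₀), if v ∉ γ.verts then x ^ γ.length *
    (α - Real.sqrt 3 * x * ∑ δ : HexMidEdgeSAW ((Λ \ γ.verts.toFinset).erase v) s(v, w₁) s(v, w₂), x ^ δ.length) else 0 with hs₀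
  set s₁ : ℝ := ∑ γ : HexMidEdgeSAW Λ a s(v, w₁), if v ∉ γ.verts then x ^ γ.length *
    (α - Real.sqrt 3 * x * ∑ δ : HexMidEdgeSAW ((Λ \ γ.verts.toFinset).erase v) s(v, w₂) s(v, w₀), x ^ δ.length) else 0 with hs₁
  set s₂ : ℝ := ∑ γ : HexMidEdgeSAW Λ a s(v, w₂), if v ∉ γ.verts then x ^ γ.length *
    (α - Real.sqrt 3 * x * ∑ δ : HexMidEdgeSAW ((Λ \ γ.verts.toFinset).erase v) s(v, w₀) s(v, w₁), x ^ δ.length) else 0 with hs₂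
  set b₀ : ℝ := ∑ γ : HexMidEdgeSAW Λ a s(v, w₀), if v ∉ γ.verts then x ^ γ.length *
    (β + Real.sqrt 3 * x * ∑ δ : HexMidEdgeSAW ((Λ \ γ.verts.toFinset).erase v) s(v, w₁) s(v, w₂), x ^ δ.length) else 0 with hb₀
  set b₁ : ℝ := ∑ γ : HexMidEdgeSAW Λ a s(v, w₁), if v ∉ γ.verts then x ^ γ.length *
    (β + Real.sqrt 3 * x * ∑ δ : HexMidEdgeSAW ((Λ \ γ.verts.toFinset).erase v) s(v, w₂) s(v, w₀), x ^ δ.length) else 0 with hb₁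
  set b₂ : ℝ := ∑ γ : HexMidEdgeSAW Λ a s(v, w₂), if v ∉ γ.verts then x ^ γ.length *
    (β + Real.sqrt 3 * x * ∑ δ : HexMidEdgeSAW ((Λ \ γ.verts.toFinset).erase v) s(v, w₀) s(v, w₁), x ^ δ.length) else 0 with hb₂
  -- slit loop bounds (`≤ c`; slit domains are simply connected)
  have loop_bd : ∀ (e p q : HexVertex), hexGraph.Adj v e → hexGraph.Adj v p → hexGraph.Adj v q →
      e ≠ p → e ≠ q → p ≠ q → ∀ γ : HexMidEdgeSAW Λ a s(v, e), v ∉ γ.verts →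
      0 ≤ ∑ δ : HexMidEdgeSAW ((Λ \ γ.verts.toFinset).erase v) s(v, p) s(v, q), x ^ δ.length ∧
      (∑ δ : HexMidEdgeSAW ((Λ \ γ.verts.toFinset).erase v) s(v, p) s(v, q), x ^ δ.length) ≤ c := by
    intro e p q he hp hq hep heq hpq γ hγ
    refine ⟨Finset.sum_nonneg fun δ _ => pow_nonneg x0 _, ?_⟩
    have heγ : e ∈ γ.verts := mem_verts_of_firstArrival hva γ hγ
    have he' : e ∉ Λ \ γ.verts.toFinset := fun h =>
      (Finset.mem_sdiff.1 h).2 (List.mem_toFinset.2 heγ)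
    have hv' : v ∈ Λ \ γ.verts.toFinset :=
      Finset.mem_sdiff.2 ⟨hv, fun h => hγ (List.mem_toFinset.1 h)⟩
    exact HL _ (stub_slitSC Λ hΛ a ha _ γ) e v p q he' hv' he hp hq hep heq hpq
  -- termwise one-sided dressing facts
  have term_bd : ∀ Zγ : ℝ, 0 ≤ Zγ → Zγ ≤ c →
      0 ≤ α - Real.sqrt 3 * x * Zγ ∧
      6137 / 10000 * (α - Real.sqrt 3 * x * Zγ) ≤ β + Real.sqrt 3 * x * Zγ ∧
      β + Real.sqrt 3 * x * Zγ ≤ 1 * (α - Real.sqrt 3 * x * Zγ) :=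
    fun Zγ hZ0 hZc => dressed_oneSided hc hZ0 hZc
  -- bounds on the real masses
  have L0 := fun (γ : HexMidEdgeSAW Λ a s(v, w₀)) (hγ : v ∉ γ.verts) =>
    loop_bd w₀ w₁ w₂ h₀ h₁ h₂ h₀₁ h₀₂ h₁₂ γ hγ
  have L1 := fun (γ : HexMidEdgeSAW Λ a s(v, w₁)) (hγ : v ∉ γ.verts) =>
    loop_bd w₁ w₂ w₀ h₁ h₂ h₀ h₁₂ h₀₁.symm h₀₂.symm γ hγ
  have L2 := fun (γ : HexMidEdgeSAW Λ a s(v, w₂)) (hγ : v ∉ γ.verts) =>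
    loop_bd w₂ w₀ w₁ h₂ h₀ h₁ h₀₂.symm h₁₂.symm h₀₁ γ hγ
  have hs0 : 0 ≤ s₀ := sum_ite_pow_mul_nonneg _ x0 _ fun γ hγ => (term_bd _ (L0 γ hγ).1 (L0 γ hγ).2).1
  have hs1 : 0 ≤ s₁ := sum_ite_pow_mul_nonneg _ x0 _ fun γ hγ => (term_bd _ (L1 γ hγ).1 (L1 γ hγ).2).1
  have hs2 : 0 ≤ s₂ := sum_ite_pow_mul_nonneg _ x0 _ fun γ hγ => (term_bd _ (L2 γ hγ).1 (L2 γ hγ).2).1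
  have hb0l : 6137 / 10000 * s₀ ≤ b₀ :=
    sum_ite_pow_mul_ge _ x0 _ _ fun γ hγ => (term_bd _ (L0 γ hγ).1 (L0 γ hγ).2).2.1
  have hb1l : 6137 / 10000 * s₁ ≤ b₁ :=
    sum_ite_pow_mul_ge _ x0 _ _ fun γ hγ => (term_bd _ (L1 γ hγ).1 (L1 γ hγ).2).2.1
  have hb2l : 6137 / 10000 * s₂ ≤ b₂ :=
    sum_ite_pow_mul_ge _ x0 _ _ fun γ hγ => (term_bd _ (L2 γ hγ).1 (L2 γ hγ).2).2.1
  have hb0u' : b₀ ≤ 1 * s₀ := sum_ite_pow_mul_le _ x0 _ _ fun γ hγ => (term_bd _ (L0 γ hγ).1 (L0 γ hγ).2).2.2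
  have hb1u' : b₁ ≤ 1 * s₁ := sum_ite_pow_mul_le _ x0 _ _ fun γ hγ => (term_bd _ (L1 γ hγ).1 (L1 γ hγ).2).2.2
  have hb2u' : b₂ ≤ 1 * s₂ := sum_ite_pow_mul_le _ x0 _ _ fun γ hγ => (term_bd _ (L2 γ hγ).1 (L2 γ hγ).2).2.2
  have hb0u : b₀ ≤ s₀ := by rwa [one_mul] at hb0u'
  have hb1u : b₁ ≤ s₁ := by rwa [one_mul] at hb1u'
  have hb2u : b₂ ≤ s₂ := by rwa [one_mul] at hb2u'
  -- phase factorisations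
  have E1S : S1 = Complex.exp (-Complex.I * (5 / 8 : ℝ) * W) * (s₁ : ℂ) :=
    sum_ite_weight_mul_eq _ W x (5 / 8) _ hW₁
  have E1B : B1 = Complex.exp (-Complex.I * (5 / 8 : ℝ) * W) * (b₁ : ℂ) :=
    sum_ite_weight_mul_eq _ W x (5 / 8) _ hW₁
  have E2S : S2 = Complex.exp (-Complex.I * (5 / 8 : ℝ) * ((W + -(2 * Real.pi / 3) : ℝ) : ℂ)) * (s₂ : ℂ) :=
    sum_ite_weight_mul_eq _ (W + -(2 * Real.pi / 3)) x (5 / 8) _ hW₂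
  have E2B : B2 = Complex.exp (-Complex.I * (5 / 8 : ℝ) * ((W + -(2 * Real.pi / 3) : ℝ) : ℂ)) * (b₂ : ℂ) :=
    sum_ite_weight_mul_eq _ (W + -(2 * Real.pi / 3)) x (5 / 8) _ hW₂
  have E0S : S0 = Complex.exp (-Complex.I * (5 / 8 : ℝ) * ((W + δ₀ : ℝ) : ℂ)) * (s₀ : ℂ) :=
    sum_ite_weight_mul_eq _ (W + δ₀) x (5 / 8) _ hW₀
  have E0B : B0 = Complex.exp (-Complex.I * (5 / 8 : ℝ) * ((W + δ₀ : ℝ) : ℂ)) * (b₀ : ℂ) :=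
    sum_ite_weight_mul_eq _ (W + δ₀) x (5 / 8) _ hW₀
  set e : ℂ := Complex.exp (-Complex.I * (5 / 8 : ℝ) * W) with he
  have hen : ‖e‖ = 1 := by
    rw [he, show -Complex.I * (5 / 8 : ℝ) * (W : ℂ) = ((-((5 / 8 : ℝ) * W) : ℝ) : ℂ) * Complex.I by
      push_cast; ring, Complex.norm_exp_ofReal_mul_I]
  set Q : ℂ := Complex.exp ((5 * Real.pi / 12 : ℝ) * Complex.I) with hQ
  set Qb : ℂ := Complex.exp (-((5 * Real.pi / 12 : ℝ) * Complex.I)) with hQb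
  have hQn : ‖Q‖ = 1 := by rw [hQ, Complex.norm_exp_ofReal_mul_I]
  have hQsigma : Complex.exp (Complex.I * (5 / 8 : ℝ) * ((2 * Real.pi / 3 : ℝ) : ℂ)) = Q := by
    rw [hQ]; exact exp_sigma_eq
  rw [E0S, E0B, E1S, E1B, E2S, E2B, exp_sub_phase, hQsigma] at H1
  rcases hε' with rfl | rfl
  · /- `y → w₀ → v` turns LEFT: `δ₀ = 2π/3`, classes `(w₂, w₁, w₀)` consecutive, middle port `w₁` -/
    refine ⟨fun _ => ?_, fun hright => ?_⟩
    swap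
    · exfalso
      rw [hright] at Tyv
      have := Real.pi_pos
      linarith
    have hδ : δ₀ = 2 * Real.pi / 3 := by rw [hδ₀]; ring
    have hph : Complex.exp (-Complex.I * (5 / 8 : ℝ) * ((W + δ₀ : ℝ) : ℂ)) = e * Qb := by
      rw [exp_add_phase, hδ, hQb, exp_neg_sigma_eq]
    rw [hph] at H1
    have eL : e * Qb * (b₀ : ℂ) + ω * (e * (b₁ : ℂ)) + ω ^ 2 * (e * Q * (b₂ : ℂ)) =
        ω * e * ((b₁ : ℂ) + b₂ * (ω * Q) + b₀ * (ω ^ 2 * Qb)) := by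
      have hω3 : ω ^ 3 = 1 := omega_pow_three
      linear_combination (-(e * Qb * (b₀ : ℂ))) * hω3
    have eR : e * Qb * (s₀ : ℂ) + e * (s₁ : ℂ) + e * Q * (s₂ : ℂ) = e * ((s₁ : ℂ) + s₂ * Q + s₀ * Qb) := by ring
    rw [eL, eR] at H1
    simp only [norm_mul, hω1, hen, one_mul] at H1
    rw [hω, hQ, hQb, omega_mul_expQ, omega_sq_mul_exp_neg] at H1
    have key := three_class_necessary hs1 hs2 hs0 hk.le hb1u hb2l hb0l H1
    rwa [min_comm, max_comm] at key
  · /- `y → w₀ → v` turns RIGHT: `δ₀ = -4π/3`, classes `(w₀, w₂, w₁)` consecutive, middle port `w₂` -/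
    refine ⟨fun hleft => ?_, fun _ => ?_⟩
    · exfalso
      rw [hleft] at Tyv
      have := Real.pi_pos
      linarith
    have hδ : δ₀ = -(4 * Real.pi / 3) := by rw [hδ₀]; ring
    have hph : Complex.exp (-Complex.I * (5 / 8 : ℝ) * ((W + δ₀ : ℝ) : ℂ)) = e * Q ^ 2 := by
      rw [exp_add_phase, hδ, hQ, exp_neg_sigma_neg_four_pi_div_three]
    rw [hph] at H1
    have eL : e * Q ^ 2 * (b₀ : ℂ) + ω * (e * (b₁ : ℂ)) + ω ^ 2 * (e * Q * (b₂ : ℂ)) =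
        ω ^ 2 * Q * e * ((b₂ : ℂ) + b₀ * (ω * Q) + b₁ * (ω ^ 2 * Qb)) := by
      have hω3 : ω ^ 3 = 1 := omega_pow_three
      have hQQ : Q * Qb = 1 := by
        rw [hQ, hQb, ← Complex.exp_add, add_neg_cancel, Complex.exp_zero]
      linear_combination (-(e * Q ^ 2 * (b₀ : ℂ)) - e * (b₁ : ℂ) * ω * Q * Qb) * hω3 +
        (-(e * (b₁ : ℂ) * ω)) * hQQ
    have eR : e * Q ^ 2 * (s₀ : ℂ) + e * (s₁ : ℂ) + e * Q * (s₂ : ℂ) =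
        Q * e * ((s₂ : ℂ) + s₀ * Q + s₁ * Qb) := by
      have hQQ : Q * Qb = 1 := by
        rw [hQ, hQb, ← Complex.exp_add, add_neg_cancel, Complex.exp_zero]
      linear_combination (-(e * (s₁ : ℂ))) * hQQ
    rw [eL, eR] at H1
    simp only [norm_mul, norm_pow, hω1, hQn, hen, one_pow, one_mul] at H1
    rw [hω, hQ, hQb, omega_mul_expQ, omega_sq_mul_exp_neg] at H1
    exact three_class_necessary hs2 hs0 hs1 hk.le hb2u hb0l hb1l H1

end Summit.CriticalPhenomena.SAWScalingLimit.Theorems.SAWDevelopingMapNoFoldBound
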